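import Summits.BirchSwinnertonDyer.BirchSwinnertonDyer.Theorems.SignedLowerHalvesSmallImageLowerHalfBothSignsLambdaLowerThreeNsThetaTransport
import Summits.BirchSwinnertonDyer.BirchSwinnertonDyer.Theorems.SignedLowerHalvesSmallImageLowerHalfBothSignsRttEngineCMCurve
import Summits.BirchSwinnertonDyer.BirchSwinnertonDyer.Theorems.SignedLowerHalvesSmallImageLowerHalfBothSignsRttCMCurveNewformIsCMForm
import Summits.BirchSwinnertonDyer.BirchSwinnertonDyer.Theorems.SignedLowerHalvesSmallImageLowerHalfBothSignsLambdaLowerThreeNsThetaPartnerSansLevel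
import Summits.BirchSwinnertonDyer.BirchSwinnertonDyer.Theorems.SignedLowerHalvesSmallImageLowerHalfBothSignsLambdaLowerThreeNsThetaPartnerLevelMatch
import Summits.BirchSwinnertonDyer.BirchSwinnertonDyer.Theorems.ResidualThetaTransportAtTwoCohomologicalPlusPeriodSupplyPeriods
import Literature.NumberTheory.EllipticCurves.KrausOesterle1992.TraceCongruenceOfTorsionIsoProofs
import Literature.NumberTheory.EllipticCurves.PlusMinusPAdicLFunctionProofs
import Literature.NumberTheory.EllipticCurves.SupersingularIrreducibleProofs
import Literature.NumberTheory.DiophantineGeometry.Conductor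
import HarnessLib

/-!
# Route `SignedLowerHalves`, crux L `SmallImageLowerHalfBothSigns` (item stmt-BirchSwinnertonDyer-23599), line `rtt_w3` v4:
# the engine TIERED, part A — the transport from a FIXED partner (§1) and the T1 SUPPLY for a CM-curve partner (§2)

LEAD `cruxlead-stmt-BirchSwinnertonDyer-23599` g2 (cell `bsd-ssimc`); helper `--supports stmt-BirchSwinnertonDyer-23599`;
THEOREMS ONLY — no definition, no named fact, no `sorry`; a sorry-free SKELETON-SHAPED composition, not a proof of crux L;
BSD is not proved by any of this.

HONEST FRAMING. v3 (`…RttOneSidedCrux`, p741163) concludes crux L BY NAME from print ∧ the one-sign `μ`-floor at `p ≥ 5` ∧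
K0₂ ∧ Kan₂ ∧ the ONE-SIDED engine, split as AN_W (landed p744056) ∧ ENG (`stub_partnerLayerLambdaLower_ns`, quantified over
EVERY level-matched CM partner). ENG is PROVED for a CM-CURVE partner `g = f_A` (`…RttEngineCMCurve`, p745857, from Kobayashi
Thm 1.2, B. D. Kim 2009 Cor 2.13 and Pollack–Rubin 2004 by name) — tier T1, 79 of the 136 open census pairs. This file makes the
T1 discharge VISIBLE IN THE COMPOSITION: the one-sided transport is proved from a FIXED partner (§1); on a pair `(W, p)` that HAS a
CM elliptic curve `A/ℚ` (good supersingular at `p`, `a_p(A) = 0`, `A[p] ≃ W[p]` `Γ_ℚ`-equivariantly) the partner is `f_A` itself —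
§2 supplies every K0₂-clause for it from tree theorems (modularity `exists_isNewformOf` by name; level clause = p742955's
`levelMatch`; trace congruence = Kraus–Oesterlé; CM form = `isCMForm_liftToGamma1_of_isNewformOf_of_hasCM`; cohomological period =
`CohomologicalPeriod.exists_isCohomologicalPlusPeriod`; Pollack pair = `pollack_exists_plusMinusPAdicLFunction_holds`; `ϖ_A` = the
period-unit facts `h5`/`h3`) and ENG is the landed T1 theorem; on the other pairs (T2) the partner is K0₂'s and ENG is asked ONLY
THERE (`hENG2` = the registered ENG text with the extra hypothesis «no CM-curve partner»). §4 = v3's class-wide theorem with this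
tiered transport: crux L BY NAME from the v4 stub texts.

* §1 `lamTransport_le_of_partner` — fixed partner: Kan₂-at-the-partner ∧ ENG-at-the-partner ∧ AN_W ⟹ `λ(G) ≤ λ(X^ε)`.
* §2 `cmCurvePartner_supply` — T1: every K0₂-clause (+ `ϖ_A`, a Pollack pair) for `f_A`.
* (part B, `…RttOneSidedCruxTiered`) §3 `lamTransport_le_tiered` (T1/T2 case split) and §4
  `smallImageLowerHalfBothSigns_of_oneSignFloor_of_rtt_ge_tiered` — crux L BY NAME (v4 composition target).

References: [Kobayashi2003] Thm. 1.2, 4.1, 7.4, Conjecture (p. 2); [BDKim2009] Cor. 2.13; [PollackRubin2004] Theorem (p. 448);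
[KrausOesterle1992] §3 Prop. 3; [Ribet1977Nebentypus] §3; [PollackWeston2011MT] Def. 2.1, §3.1, Thm. 4.1; [GreenbergVatsal2000] Prop. (2.4),
§3 Rem. 3.4; [BreuilConradDiamondTaylor2001] Thm. A; [Pollack2003] Thm. 5.6, Prop. 6.18.
-/

set_option autoImplicit false
-- D-0017: single-problem summit, the namespace repeats the problem name by design.
set_option linter.dupNamespace false
noncomputable section

open scoped Classical MatrixGroups ModularForm BigOperators

open CongruenceSubgroup WeierstrassCurve Field Polynomial NumberField IsDedekindDomain
  Literature.NumberTheory.EllipticCurves Literature.NumberTheory.EllipticCurves.ModularForms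
  Literature.NumberTheory.EllipticCurves.Rank1Residual
  Literature.NumberTheory.EllipticCurves.Kobayashi2003
  Literature.NumberTheory.EllipticCurves.GreenbergVatsal2000 ZpExtension
  Literature.NumberTheory.IwasawaTheory Rat.HeightOneSpectrum
  Summit.BirchSwinnertonDyer.Rank1Residual.Supersingular
  Summit.BirchSwinnertonDyer.Rank1Residual.X1.MuLambda
  Summit.BirchSwinnertonDyer.Rank1Residual.X2.EulerFactorInvariants
  Summit.BirchSwinnertonDyer.BirchSwinnertonDyer.Theorems.SmallImageLambdaLowerThreeNsThetaTransport

namespace Summit.BirchSwinnertonDyer.BirchSwinnertonDyer.Theorems.SmallImageRttOneSided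

/-! ## §1 The one-sided transport from a FIXED partner -/

section Partner

variable (W : WeierstrassCurve ℚ) [W.IsElliptic] [W.IsGloballyMinimal] (p : ℕ) [Fact p.Prime]

omit [W.IsGloballyMinimal] in
/-- **One-sided λ-transport at `(W, p, ε)` from ONE partner.** GIVEN a partner datum `(M, g, ι, Ω)` with `p ∤ M`, the layer-λ
EQUALITY of the `S₀`-depleted Mazur–Tate elements of `W` and `g` AT THIS PARTNER for `n ≫ 0` of the parity of `ε` (`han`, Kan₂
specialised), and ENG AT THIS PARTNER (`heng`: `λ_n(θ^{S₀}_n(g)^ι) ≤ deg ω_n^{−ε} + λ(X^ε_W) + Σ_{v∈S₀} δ_W^{(v)}`), the one-sided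
transport `λ(G) ≤ λ(X^ε_W)` holds for every `G` with `ι G = C(p^m ϖ)·ι L^ε` — AN_W (`SmallImageRttLayerLaw.eventually_layerLambda_depleted_of_isPollackPair`,
p744056) supplies `λ_n(θ^{S₀}_n(f)) = λ(L^ε) + Σδ + deg ω_n^{−ε}`; `S₀` from `exists_depletionPlaces`; integer arithmetic.
Nothing is asserted. [cite: PollackWeston2011MT, §3.1, Thm. 4.1 (1)] [cite: GreenbergVatsal2000, §2 Prop. (2.4)] -/
theorem lamTransport_le_of_partner (hp : p ≠ 2) (hgood : W.HasGoodReductionAtPrime p) (ε : ℤˣ)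
    {M : ℕ} [NeZero M] (g : CuspForm (Gamma0 M) 2) (ι : coeffField g →+* PadicAlgCl p) (Ω : ℂ) (hpM : ¬ p ∣ M)
    (han : ∀ [NeZero (W.conductorNorm ℤ)] (f : CuspForm (Gamma0 (W.conductorNorm ℤ)) 2), IsNewformOf W f →
        ∀ (Lplus Lminus : IwasawaAlgebra p), IsPollackPair f p Lplus Lminus →
          HasUnitContent (kobayashiL ε Lplus Lminus) →
        ∀ (S₀ : Finset (HeightOneSpectrum (𝓞 ℚ))), (∀ v ∈ S₀, ((p : ℕ) : 𝓞 ℚ) ∉ v.asIdeal) →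
          (∀ v : HeightOneSpectrum (𝓞 ℚ), ¬ W.HasGoodReductionAt v → v ∈ S₀) →
          (∀ v : HeightOneSpectrum (𝓞 ℚ), natGenerator v ∣ M → v ∈ S₀) →
        ∃ n₀ : ℕ, ∀ n ≥ n₀, (Even n ↔ ε = 1) →
          layerLambda (((mazurTateElement f p n).map (algebraMap ℚ (PadicAlgCl p)) *
              ∏ v ∈ S₀, ((W.localPolynomialAt v).map (Int.castRingHom (PadicAlgCl p))).comp
                (C ((natGenerator v : PadicAlgCl p)⁻¹) *
                  (X + 1) ^ (PadicInt.toZModPow n (-(frobeniusExponent p (natGenerator v : ℤ_[p])))).val)) %ₘ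
              ((X + 1) ^ p ^ n - 1)) =
          layerLambda (((mazurTateElementK g Ω p n).map ι *
              ∏ v ∈ S₀, (1 - C (embCoeff g ι (natGenerator v)) * X +
                  (if natGenerator v ∣ M then 0 else C (natGenerator v : PadicAlgCl p)) * X ^ 2).comp
                (C ((natGenerator v : PadicAlgCl p)⁻¹) *
                  (X + 1) ^ (PadicInt.toZModPow n (-(frobeniusExponent p (natGenerator v : ℤ_[p])))).val)) %ₘ
              ((X + 1) ^ p ^ n - 1)))
    (heng : ∀ (κ : ZpExtension ℚ p) (γ : absoluteGaloisGroup ℚ),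
          κ.IsCyclotomic → κ.IsTopGenerator γ → IsCyclotomicVariable p γ →
        ∀ (S₀ : Finset (HeightOneSpectrum (𝓞 ℚ))), (∀ v ∈ S₀, ((p : ℕ) : 𝓞 ℚ) ∉ v.asIdeal) →
          (∀ v : HeightOneSpectrum (𝓞 ℚ), ¬ W.HasGoodReductionAt v → v ∈ S₀) →
          (∀ v : HeightOneSpectrum (𝓞 ℚ), natGenerator v ∣ M → v ∈ S₀) →
        ∀ (D : SignedSelmerDualData W κ γ ε) [Module.Finite (IwasawaAlgebra p) D.X],
          Module.IsTorsion (IwasawaAlgebra p) D.X → D.mu = 0 →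
        ∃ n₀ : ℕ, ∀ n ≥ n₀, (Even n ↔ ε = 1) →
          ((layerLambda (((mazurTateElementK g Ω p n).map ι *
              ∏ v ∈ S₀, (1 - C (embCoeff g ι (natGenerator v)) * X +
                  (if natGenerator v ∣ M then 0 else C (natGenerator v : PadicAlgCl p)) * X ^ 2).comp
                (C ((natGenerator v : PadicAlgCl p)⁻¹) *
                  (X + 1) ^ (PadicInt.toZModPow n (-(frobeniusExponent p (natGenerator v : ℤ_[p])))).val)) %ₘ
              ((X + 1) ^ p ^ n - 1)) : ℕ) : ℤ) ≤
            ((if ε = 1 then cyclotomicOmegaMinus p n else cyclotomicOmegaPlus p n).natDegree : ℤ) +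
              ((lambdaInvariant p D.X : ℕ) : ℤ) + ((∑ v ∈ S₀, delta W p v : ℕ) : ℤ))
    (κ : ZpExtension ℚ p) (γ : absoluteGaloisGroup ℚ) (hκ : κ.IsCyclotomic) (hγ : κ.IsTopGenerator γ)
    (hγ' : IsCyclotomicVariable p γ)
    [NeZero (W.conductorNorm ℤ)] (f : CuspForm (Gamma0 (W.conductorNorm ℤ)) 2) (hf : IsNewformOf W f)
    (ϖ : ℚ) (hϖ : (ϖ : ℝ) * W.realPeriodRat = plusPeriod f)
    (Lplus Lminus : IwasawaAlgebra p) (hPP : IsPollackPair f p Lplus Lminus)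
    (hfloor : HasUnitContent (kobayashiL ε Lplus Lminus))
    (D : SignedSelmerDualData W κ γ ε) [Module.Finite (IwasawaAlgebra p) D.X]
    (hX : Module.IsTorsion (IwasawaAlgebra p) D.X) (hμ : D.mu = 0)
    (G : IwasawaAlgebra p) (m : ℕ)
    (hG : iwasawaToPowerSeries p G =
      PowerSeries.C ((p : ℚ_[p]) ^ m * (ϖ : ℚ_[p])) * iwasawaToPowerSeries p (kobayashiL ε Lplus Lminus)) :
    lam G ≤ lambdaInvariant p D.X := by
  obtain ⟨S₀, hS₀p, hS₀W, hS₀M⟩ := exists_depletionPlaces W p hgood M hpM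
  obtain ⟨n₁, hn₁⟩ := han f hf Lplus Lminus hPP hfloor S₀ hS₀p hS₀W hS₀M
  have hS' : ∀ v ∈ S₀, natGenerator v ≠ p := fun v hv ↦ natGenerator_ne_of_natCast_not_mem v (hS₀p v hv)
  obtain ⟨n₂, hn₂⟩ :=
    Summit.BirchSwinnertonDyer.BirchSwinnertonDyer.Theorems.SmallImageRttLayerLaw.eventually_layerLambda_depleted_of_isPollackPair
      W hp f hPP ε S₀ hS'
  obtain ⟨n₃, hn₃⟩ := heng κ γ hκ hγ hγ' S₀ hS₀p hS₀W hS₀M D hX hμ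
  obtain ⟨n, h1n, h23n, hpar⟩ := exists_layer_ge_of_sign ε n₁ (max n₂ n₃)
  have h1 := hn₁ n h1n hpar
  have h2 := hn₂ n (le_of_max_le_left h23n) hpar
  have h3 := hn₃ n (le_of_max_le_right h23n) hpar
  -- `λ(G) = λ(L^ε)`
  set L := kobayashiL ε Lplus Lminus with hLdef
  have hL0 : L ≠ 0 := by
    rcases Int.units_eq_one_or ε with rfl | rfl
    · simpa [hLdef, kobayashiL] using hPP.2.1
    · have : kobayashiL (-1) Lplus Lminus = Lplus := by simp [kobayashiL]
      rw [hLdef, this]; exact hPP.1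
  have hϖ0 : (ϖ : ℚ_[p]) ≠ 0 := by
    exact_mod_cast Summit.BirchSwinnertonDyer.Rank1Residual.X2.varpi_ne_zero_of_isNewformOf hf hϖ
  have hx0 : (p : ℚ_[p]) ^ m * (ϖ : ℚ_[p]) ≠ 0 :=
    mul_ne_zero (pow_ne_zero _ (by exact_mod_cast (Fact.out : p.Prime).ne_zero)) hϖ0
  have hlamG : lam G = lam L :=
    (Summit.BirchSwinnertonDyer.BirchSwinnertonDyer.Theorems.ResidualThetaLayer.lam_eq_of_iwasawaToPowerSeries_eq_C_mul
      hx0 hL0 hG).2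
  rw [hlamG]
  rw [h1] at h2
  have h2' := congrArg (Nat.cast : ℕ → ℤ) h2
  push_cast at h2' h3
  have : ((lam L : ℕ) : ℤ) ≤ ((lambdaInvariant p D.X : ℕ) : ℤ) := by linarith
  exact_mod_cast this

end Partner

/-! ## §2 T1: every K0₂-clause for the newform of a CM-curve partner -/

section Supply

/-- `‖z‖ < 1` in `ℚ̄_p` for an integer `z` divisible by `p`. [folklore] -/
theorem norm_intCast_padicAlgCl_lt_one_of_dvd {p : ℕ} [Fact p.Prime] {z : ℤ} (h : (p : ℤ) ∣ z) :
    ‖(z : PadicAlgCl p)‖ < 1 := by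
  rw [← map_intCast (algebraMap ℚ_[p] (PadicAlgCl p)), norm_algebraMap']
  exact Padic.norm_intCast_lt_one_iff.mpr h

/-- **T1 SUPPLY: the newform `f_A` of a CM-curve partner satisfies every partner clause of K0₂ / Kan₂ / ENG.** Let `(W, p)` be
odd-prime good with `a_p(W) = 0`, and `A/ℚ` a globally minimal CM curve, good supersingular at `p` with `a_p(A) = 0`, with a
`Γ_ℚ`-equivariant `A[p] ≃ W[p]` (`he`, oriented `W[p] → A[p]`). GRANTED BY NAME modularity (`hmod : exists_isNewformOf`), Deligne /
Carayol / Saito (`hD hC hS`, for the level clause) and the period-unit facts (`h5`, `h3`): with `M = N_A` and `g = f_A` there are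
`ι : K_g → ℚ̄_p`, a COHOMOLOGICAL plus period `Ω`, a rational `ϖ_A` with `ϖ_A·Ω_A = Ω⁺_g` and a Pollack pair of `g`, and
`p ∤ N_A`, `max 2 (v_ℓ N_A) = max 2 (v_ℓ N_W)` (`ℓ ≠ p`), `g` is a newform and a CM form, `a_p(g) = 0`, and
`‖ι a_ℓ(g) − a_ℓ(W)‖ < 1` for every prime `ℓ ∤ p·N_A·N_W` (Kraus–Oesterlé). No new mathematics: plumbing of tree theorems.
[cite: KrausOesterle1992, §3 Prop. 3 (i) ⇒ (iii)] [cite: Ribet1977Nebentypus, §3] [cite: PollackWeston2011MT, Def. 2.1]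
[cite: Pollack2003, Thm. 5.6, Prop. 6.18] [cite: GreenbergVatsal2000, §3 Rem. 3.4] [cite: BreuilConradDiamondTaylor2001, Thm. A] -/
theorem cmCurvePartner_supply (hD : Hida2000_thm326_exists_galoisRep) (hC : Carayol1986_artinConductorExponent)
    (hS : ∀ (V : WeierstrassCurve ℚ) (ℓ : ℕ) [Fact ℓ.Prime],
      V.swanConductorAt_rationalTate_eq_wildConductorExponent_of_ringChar_eq_two ℓ)
    (hmod : exists_isNewformOf)
    (h5 : realPeriodRat_eq_unit_mul_plusPeriod) (h3 : realPeriodRat_eq_unit_mul_plusPeriod_three)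
    (W A : WeierstrassCurve ℚ) [W.IsElliptic] [W.IsGloballyMinimal] [A.IsElliptic] [A.IsGloballyMinimal]
    (p : ℕ) [Fact p.Prime] (hp : p ≠ 2) (hgoodW : W.HasGoodReductionAtPrime p)
    (hcmA : A.HasCM) (hssA : GoodSS A p) (hapA : A.frobeniusTrace p = 0)
    (he : ∃ e : geomTorsion W (p : ℤ) ≃+ geomTorsion A (p : ℤ),
      ∀ (σ : absoluteGaloisGroup ℚ) (P : geomTorsion W (p : ℤ)), e (σ • P) = σ • e P) :
    ∃ (_ : NeZero (A.conductorNorm ℤ)) (g : CuspForm (Gamma0 (A.conductorNorm ℤ)) 2)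
      (ι : coeffField g →+* PadicAlgCl p) (Ω : ℂ),
      IsNewformOf A g ∧ ¬ p ∣ A.conductorNorm ℤ ∧
        (∀ ℓ : ℕ, ℓ.Prime → ℓ ≠ p → max 2 (padicValNat ℓ (A.conductorNorm ℤ)) = max 2 (padicValNat ℓ (W.conductorNorm ℤ))) ∧
        IsNewform0 g ∧ Literature.NumberTheory.Automorphic.IsCMForm (liftToGamma1 (A.conductorNorm ℤ) 2 g) ∧
        cuspCoeff g p = 0 ∧ IsCohomologicalPlusPeriod g ι Ω ∧
        (∀ ℓ : ℕ, ℓ.Prime → ¬ ℓ ∣ p * A.conductorNorm ℤ * W.conductorNorm ℤ →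
          ‖embCoeff g ι ℓ - (W.frobeniusTrace ℓ : PadicAlgCl p)‖ < 1) ∧
        (∃ ϖA : ℚ, (ϖA : ℝ) * A.realPeriodRat = plusPeriod g) ∧
        (∃ Lp Lm : IwasawaAlgebra p, IsPollackPair g p Lp Lm) := by
  have hpP : p.Prime := Fact.out
  have hgoodA : A.HasGoodReductionAtPrime p := hssA.1
  haveI hNA : NeZero (A.conductorNorm ℤ) := ⟨(A.conductorNorm_pos_holds).ne'⟩
  -- the newform of `A`
  obtain ⟨g, hg⟩ := hmod A
  have hQ : coeffField g = ⊥ := hg.coeffField_eq_bot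
  -- `ι : K_g = ℚ → ℚ̄_p`
  let ι : coeffField g →+* PadicAlgCl p :=
    (algebraMap ℚ (PadicAlgCl p)).comp
      ((IntermediateField.botEquiv ℚ ℂ).toAlgHom.toRingHom.comp (IntermediateField.equivOfEq hQ).toAlgHom.toRingHom)
  -- a cohomological plus period along `ι`
  obtain ⟨Ω, hΩ⟩ :=
    Summit.BirchSwinnertonDyer.BirchSwinnertonDyer.Theorems.CohomologicalPeriod.exists_isCohomologicalPlusPeriod hg.1 ι
  -- `p ∤ N_A`
  have hpN : ¬ p ∣ A.conductorNorm ℤ := not_dvd_level_of_isNewformOf hg hgoodA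
  -- the trace congruence off `p·N_A·N_W` (Kraus–Oesterlé)
  obtain ⟨e, hecomm⟩ := he
  have hcong : ∀ ℓ : ℕ, ℓ.Prime → ¬ ℓ ∣ p * A.conductorNorm ℤ * W.conductorNorm ℤ →
      ‖embCoeff g ι ℓ - (W.frobeniusTrace ℓ : PadicAlgCl p)‖ < 1 := by
    intro ℓ hℓ hndvd
    haveI : Fact ℓ.Prime := ⟨hℓ⟩
    have hℓp : ℓ ≠ p := fun h ↦ hndvd (h ▸ dvd_mul_of_dvd_left (dvd_mul_right ℓ _) _)
    have hℓW : W.HasGoodReductionAtPrime ℓ :=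
      hasGoodReductionAtPrime_of_not_dvd_conductorNorm W fun h ↦ hndvd (dvd_mul_of_dvd_right h _)
    have hℓA : A.HasGoodReductionAtPrime ℓ :=
      hasGoodReductionAtPrime_of_not_dvd_conductorNorm A
        fun h ↦ hndvd (dvd_mul_of_dvd_left (dvd_mul_of_dvd_right h p) _)
    have hdvd : (p : ℤ) ∣ W.frobeniusTrace ℓ - A.frobeniusTrace ℓ :=
      KrausOesterle1992.dvd_frobeniusTrace_sub_of_addEquiv_geomTorsion W A p e hecomm ℓ hℓp hℓW hℓA
    have hcoef : cuspCoeff g ℓ = ((A.frobeniusTrace ℓ : ℤ) : ℂ) := by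
      rw [hg.2 ℓ, A.LFunction_apply_prime_eq_frobeniusTrace ℓ hℓA]
    rw [embCoeff_eq_intCast g ι hcoef, ← Int.cast_sub]
    exact norm_intCast_padicAlgCl_lt_one_of_dvd (dvd_sub_comm.mp hdvd)
  -- the level clause (p742955's `levelMatch`)
  have hlev : ∀ ℓ : ℕ, ℓ.Prime → ℓ ≠ p →
      max 2 (padicValNat ℓ (A.conductorNorm ℤ)) = max 2 (padicValNat ℓ (W.conductorNorm ℤ)) :=
    fun ℓ hℓ hℓp ↦
      Summit.BirchSwinnertonDyer.BirchSwinnertonDyer.Theorems.SmallImageLambdaLowerThreeNsThetaPartner.levelMatch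
        hD hC hS W p ι hg.1 hcong hℓ hℓp
  -- `a_p(g) = a_p(A) = 0`
  have hapg : cuspCoeff g p = 0 := by
    rw [hg.2 p, A.LFunction_apply_prime_eq_frobeniusTrace p hgoodA, hapA, Int.cast_zero]
  -- `ϖ_A` from the period-unit facts (`E[p]` irreducible at a good supersingular `p`)
  have hirrA : A.HasIrreducibleModPGaloisRep p :=
    hasIrreducibleModPGaloisRep_of_dvd_frobeniusTrace A p hp
      (A.not_dvd_minimalDiscriminantInt_of_hasGoodReductionAtPrime' p hgoodA) (by rw [hapA]; exact dvd_zero _)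
  have hϖ : ∃ ϖA : ℚ, (ϖA : ℝ) * A.realPeriodRat = plusPeriod g := by
    have hp35 : p = 3 ∨ 5 ≤ p := by
      by_cases hp3 : p = 3
      · exact Or.inl hp3
      · refine Or.inr ?_
        by_contra h
        have hlt : p < 5 := by omega
        have h2 := hpP.two_le
        interval_cases p
        · exact hp rfl
        · exact hp3 rfl
        · exact absurd hpP (by decide)
    have hu : ∃ u : ℚ, ‖(u : ℚ_[p])‖ = 1 ∧ A.realPeriodRat = u * plusPeriod g := by
      rcases hp35 with hp3 | hp5
      · subst hp3
        exact h3 A hgoodA hirrA g hg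
      · exact h5 A p hp5 hgoodA hirrA g hg
    obtain ⟨u, hu1, huΩ⟩ := hu
    have hu0 : u ≠ 0 := by
      rintro rfl
      simp at hu1
    refine ⟨u⁻¹, ?_⟩
    rw [huΩ]
    push_cast
    field_simp
  -- a Pollack pair for `g` (Pollack's theorem, proved in the tree)
  have hPol : ∃ Lp Lm : IwasawaAlgebra p, IsPollackPair g p Lp Lm :=
    exists_isPollackPair pollack_exists_plusMinusPAdicLFunction_holds hp hg hgoodA hapA
  exact ⟨hNA, g, ι, Ω, hg, hpN, hlev, hg.1, isCMForm_liftToGamma1_of_isNewformOf_of_hasCM A hcmA hg, hapg, hΩ, hcong,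
    hϖ, hPol⟩

end Supply

end Summit.BirchSwinnertonDyer.BirchSwinnertonDyer.Theorems.SmallImageRttOneSided

end
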